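import Summits.QuantumFields.YangMills.Theorems.BalabanUVNodesN15KingModelPathResolvent
import HarnessLib

/-!
# BalabanUVNodes ∕ N15 — THE KING-MODEL RUNG (PART Ϲ-g′): THE TORUS-vs-BOX TWIN IN THE TIME DIRECTION — the free-boundary (box) and the periodic
# (torus) massive resolvents of the same length `n` and mass differ from the infinite-line resolvent `e^{−ω|s−t|}∕(2 sinh ω)`, and from each other,
# by IMAGES ONLY: boundary layers `e^{−ω(s+t+1)}`, `e^{−ω(2n−1−s−t)}` and windings `e^{−ω(n−|s−t|)}`, `e^{−ω(2n−|s−t|)}`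
# (Track A, DAG node N15 = NE2; FAN-OUT v1.1 §N15 s3 — its named alternative currency «torus-vs-box twin»; count-neutral)

HONEST FRAMING.  Count-neutral (cell `pub-ymgap`, seat `pub-ymgap-dag-n15-e` g38; `--supports stmt-QuantumFields-27366 --as helper` = K3⁸).
TEMPLATE LITERATURE: C. King, Commun. Math. Phys. **102** (1986) 649–677 [King1986] §4 p.670 — periodic estimates transported to boxes with free
boundary conditions «by using multiple reflection representations»; Montvay–Münster [MontvayMunster1994] §2.1.2∕§2.2.1 (the finite-`T` vs
`L = T = ∞` timeslice correlation, (2.24)).  PART Ϲ-g (`pathOp_inv_apply`) wrote the box resolvent as the even image sum of the torus resolvent of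
the doubled period; PART Ϲ-a′ bounded the torus resolvent against the infinite line by one image.  THIS FILE states the TWIN ESTIMATES in the time
direction: at the same lattice mass `ω = latticeMass x`, the box resolvent exceeds the line resolvent by at most its images (two boundary layers and
one winding of the doubled cycle), the torus resolvent by at most one winding, hence |box − torus| ≤ the sum — exponentially small in the distance to
the boundary and to the antipode, uniformly in `n`.  The decay RATE (mass) is the same for all three.  NOT Bałaban's covariant objects; NOT a node
discharge (N15 is booked through n15-a's knit, untouched); one dimension only; nothing continuum-YM ∕ ℝ⁴ ∕ OS axioms ∕ Clay.  0 `sorry`, 0 `def`.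

WHAT THIS FILE PROVES (kernel).  §1 `val_natCast_sub_natCast` (no wrap on `ℤ∕n` for `t ≤ s < n`), `cycleGreen_natCast_sub_eq` (the torus resolvent
at a box pair depends on `|s−t|`), ★ `torusGreen_sub_line_bounds` (`0 ≤ G^{torus}_n(s−t) − e^{−ω|s−t|}∕(2 sinh ω) ≤ e^{−ω(n−|s−t|)}∕(sinh ω(1−e^{−ωn}))`,
PART Ϲ-a′ read at box pairs).  §2 ★★ **`pathGreen_sub_line_nonneg`** ∕ ★★ **`pathGreen_sub_line_le`** (BOX vs LINE: `0 ≤ G^{box}_n(s,t) −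
e^{−ω|s−t|}∕(2 sinh ω) ≤ (2e^{−ω(2n−|s−t|)} + e^{−ω(s+t+1)} + e^{−ω(2n−1−s−t)})∕(2 sinh ω(1−e^{−2ωn}))`).  §3 ★★★ **`abs_pathGreen_sub_torusGreen_le`**
(TORUS vs BOX, same length and mass: `|G^{box}_n(s,t) − G^{torus}_n(s−t)| ≤ e^{−ω(n−|s−t|)}∕(sinh ω(1−e^{−ωn})) + (2e^{−ω(2n−|s−t|)} + e^{−ω(s+t+1)} +
e^{−ω(2n−1−s−t)})∕(2 sinh ω(1−e^{−2ωn}))`).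

HONEST SCOPE.  One dimension, `x > 0`; the constants are not optimised (the winding of the doubled cycle is kept as printed by the image sum).  The
`d+1`-dimensional twin for King's operators (product structure only along one axis at a time) is not asserted.  N15 untouched; counts unmoved.
Locators: [King1986] §4 p.670; [MontvayMunster1994] §2.1.2 (2.24), (2.49).
-/

noncomputable section

open scoped BigOperators
open Finset Matrix Real

namespace Summit.QuantumFields.YangMills.BalabanUVNodes.N15KingModelRung.TorusSpectral

variable (n : ℕ) [NeZero n]

/-! ## §1 The torus resolvent at box pairs -/

section TorusAtBox

omit [NeZero n] in
/-- No wrap-around on `ℤ∕n`: `val(s − t) = s − t` for `t ≤ s < n`. [folklore] -/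
theorem val_natCast_sub_natCast {s t : ℕ} (hs : s < n) (hts : t ≤ s) :
    (((s : ℕ) : ZMod n) - ((t : ℕ) : ZMod n)).val = s - t := by
  rw [← Nat.cast_sub hts, ZMod.val_cast_of_lt (by omega)]

/-- ★ THE TORUS RESOLVENT vs THE LINE at a box pair `s, t < n`: `0 ≤ G^{torus}_n(s − t) − e^{−ω|s−t|}∕(2 sinh ω) ≤ e^{−ω(n−|s−t|)}∕(sinh ω(1 − e^{−ωn}))`
(PART Ϲ-a′'s one-image bounds, `|s−t| = max − min`). [cite: MontvayMunster1994, §2.1.2 (2.24)] -/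
theorem torusGreen_sub_line_bounds {x : ℝ} (hx : 0 < x) (s t : Fin n) :
    0 ≤ cycleGreen n x (((s.val : ℕ) : ZMod n) - ((t.val : ℕ) : ZMod n))
          - Real.exp (-(latticeMass x * ((max s.val t.val - min s.val t.val : ℕ) : ℝ))) / (2 * Real.sinh (latticeMass x))
      ∧ cycleGreen n x (((s.val : ℕ) : ZMod n) - ((t.val : ℕ) : ZMod n))
          - Real.exp (-(latticeMass x * ((max s.val t.val - min s.val t.val : ℕ) : ℝ))) / (2 * Real.sinh (latticeMass x))
        ≤ Real.exp (-(latticeMass x * (n - ((max s.val t.val - min s.val t.val : ℕ) : ℝ))))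
            / (Real.sinh (latticeMass x) * (1 - Real.exp (-(latticeMass x * n)))) := by
  rcases le_total t.val s.val with hts | hst
  · set u : ZMod n := ((s.val : ℕ) : ZMod n) - ((t.val : ℕ) : ZMod n)
    have hu : u.val = max s.val t.val - min s.val t.val := by
      rw [max_eq_left hts, min_eq_right hts]; exact val_natCast_sub_natCast n s.isLt hts
    have h1 := exp_le_cycleGreen n hx u
    have h2 := cycleGreen_sub_exp_le n hx u
    rw [hu] at h1 h2
    exact ⟨sub_nonneg.mpr h1, h2⟩
  · set u : ZMod n := ((t.val : ℕ) : ZMod n) - ((s.val : ℕ) : ZMod n)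
    have hneg : cycleGreen n x (((s.val : ℕ) : ZMod n) - ((t.val : ℕ) : ZMod n)) = cycleGreen n x u := by
      rw [show ((s.val : ℕ) : ZMod n) - ((t.val : ℕ) : ZMod n) = -u by simp [u], cycleGreen_neg]
    have hu : u.val = max s.val t.val - min s.val t.val := by
      rw [max_eq_right hst, min_eq_left hst]; exact val_natCast_sub_natCast n t.isLt hst
    have h1 := exp_le_cycleGreen n hx u
    have h2 := cycleGreen_sub_exp_le n hx u
    rw [hu] at h1 h2
    rw [hneg]
    exact ⟨sub_nonneg.mpr h1, h2⟩

end TorusAtBox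

/-! ## §2 The box resolvent vs the infinite line: images only -/

section BoxVsLine

/-- The direct image term of the box: `G^{torus}_{2n}(dbl s − dbl t)` obeys PART Ϲ-a′'s one-image bounds with period `2n` and separation `|s−t|`.
[cite: King1986, §4 p.670] -/
theorem boxDirect_sub_line_bounds {x : ℝ} (hx : 0 < x) (s t : Fin n) :
    0 ≤ cycleGreen (2 * n) x (dbl n s - dbl n t)
          - Real.exp (-(latticeMass x * ((max s.val t.val - min s.val t.val : ℕ) : ℝ))) / (2 * Real.sinh (latticeMass x))
      ∧ cycleGreen (2 * n) x (dbl n s - dbl n t)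
          - Real.exp (-(latticeMass x * ((max s.val t.val - min s.val t.val : ℕ) : ℝ))) / (2 * Real.sinh (latticeMass x))
        ≤ Real.exp (-(latticeMass x * (((2 * n : ℕ) : ℝ) - ((max s.val t.val - min s.val t.val : ℕ) : ℝ))))
            / (Real.sinh (latticeMass x) * (1 - Real.exp (-(latticeMass x * ((2 * n : ℕ) : ℝ))))) := by
  have hs2 : s.val < 2 * n := by omega
  have ht2 : t.val < 2 * n := by omega
  have key := torusGreen_sub_line_bounds (2 * n) hx ⟨s.val, hs2⟩ ⟨t.val, ht2⟩
  simpa [dbl] using key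

omit [NeZero n] in
/-- The mirror image term of the box in exponential form: `G^{torus}_{2n}(s + t + 1) = (e^{−ω(s+t+1)} + e^{−ω(2n−1−s−t)})∕(2 sinh ω(1 − e^{−2ωn}))`.
[cite: King1986, §4 p.670] -/
theorem boxMirror_eq_exp (x : ℝ) (s t : Fin n) :
    cycleGreen (2 * n) x (dbl n s - mirror n t)
      = (Real.exp (-(latticeMass x * (s.val + t.val + 1))) + Real.exp (-(latticeMass x * (((2 * n : ℕ) : ℝ) - 1 - s.val - t.val))))
          / (2 * Real.sinh (latticeMass x) * (1 - Real.exp (-(latticeMass x * ((2 * n : ℕ) : ℝ))))) := by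
  rw [cycleGreen_eq_exp, val_dbl_sub_mirror]
  congr 2
  · push_cast; ring
  · congr 1; push_cast; ring

/-- ★★ **BOX vs LINE, lower side**: the free-boundary resolvent dominates the infinite-line one, `e^{−ω|s−t|}∕(2 sinh ω) ≤ G^{box}_n(s,t)` (all images are
positive). [cite: King1986, §4 p.670] -/
theorem pathGreen_sub_line_nonneg {x : ℝ} (hx : 0 < x) (s t : Fin n) :
    0 ≤ pathGreen n x s t - Real.exp (-(latticeMass x * ((max s.val t.val - min s.val t.val : ℕ) : ℝ))) / (2 * Real.sinh (latticeMass x)) := by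
  unfold pathGreen
  have h1 := (boxDirect_sub_line_bounds n hx s t).1
  have h2 := cycleGreen_pos (2 * n) hx (dbl n s - mirror n t)
  linarith

/-- ★★ **BOX vs LINE, upper side**: `G^{box}_n(s,t) − e^{−ω|s−t|}∕(2 sinh ω) ≤ (2e^{−ω(2n−|s−t|)} + e^{−ω(s+t+1)} + e^{−ω(2n−1−s−t)})∕(2 sinh ω(1 − e^{−2ωn}))`
— the excess consists of images only: one winding of the doubled cycle and the two boundary layers. [cite: King1986, §4 p.670; MontvayMunster1994, §2.1.2 (2.24)] -/
theorem pathGreen_sub_line_le {x : ℝ} (hx : 0 < x) (s t : Fin n) :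
    pathGreen n x s t - Real.exp (-(latticeMass x * ((max s.val t.val - min s.val t.val : ℕ) : ℝ))) / (2 * Real.sinh (latticeMass x))
      ≤ (2 * Real.exp (-(latticeMass x * (((2 * n : ℕ) : ℝ) - ((max s.val t.val - min s.val t.val : ℕ) : ℝ))))
          + Real.exp (-(latticeMass x * (s.val + t.val + 1))) + Real.exp (-(latticeMass x * (((2 * n : ℕ) : ℝ) - 1 - s.val - t.val))))
        / (2 * Real.sinh (latticeMass x) * (1 - Real.exp (-(latticeMass x * ((2 * n : ℕ) : ℝ))))) := by
  unfold pathGreen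
  have h1 := (boxDirect_sub_line_bounds n hx s t).2
  have h2 := boxMirror_eq_exp n x s t
  have hs : 0 < Real.sinh (latticeMass x) := Real.sinh_pos_iff.mpr (latticeMass_pos hx)
  have hq : 0 < 1 - Real.exp (-(latticeMass x * ((2 * n : ℕ) : ℝ))) := one_sub_exp_period_pos (2 * n) hx
  have hsplit : (2 * Real.exp (-(latticeMass x * (((2 * n : ℕ) : ℝ) - ((max s.val t.val - min s.val t.val : ℕ) : ℝ))))
          + Real.exp (-(latticeMass x * (s.val + t.val + 1))) + Real.exp (-(latticeMass x * (((2 * n : ℕ) : ℝ) - 1 - s.val - t.val))))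
        / (2 * Real.sinh (latticeMass x) * (1 - Real.exp (-(latticeMass x * ((2 * n : ℕ) : ℝ)))))
      = Real.exp (-(latticeMass x * (((2 * n : ℕ) : ℝ) - ((max s.val t.val - min s.val t.val : ℕ) : ℝ))))
            / (Real.sinh (latticeMass x) * (1 - Real.exp (-(latticeMass x * ((2 * n : ℕ) : ℝ)))))
        + (Real.exp (-(latticeMass x * (s.val + t.val + 1))) + Real.exp (-(latticeMass x * (((2 * n : ℕ) : ℝ) - 1 - s.val - t.val))))
            / (2 * Real.sinh (latticeMass x) * (1 - Real.exp (-(latticeMass x * ((2 * n : ℕ) : ℝ))))) := by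
    field_simp
    ring
  rw [hsplit]
  linarith

end BoxVsLine

/-! ## §3 The torus-vs-box twin -/

section Twin

/-- ★★★ **THE TORUS-vs-BOX TWIN (time direction)**: at the same length `n` and mass, the free-boundary (box) and periodic (torus) resolvents differ by
images only — `|G^{box}_n(s,t) − G^{torus}_n(s − t)| ≤ e^{−ω(n−|s−t|)}∕(sinh ω(1 − e^{−ωn})) + (2e^{−ω(2n−|s−t|)} + e^{−ω(s+t+1)} +
e^{−ω(2n−1−s−t)})∕(2 sinh ω(1 − e^{−2ωn}))` — exponentially small in the distance to the boundary and to the antipode, uniformly in `n`; the decay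
rate `ω = latticeMass x` is the same for both boundary conditions. [cite: King1986, §4 p.670; MontvayMunster1994, §2.1.2 (2.24)] -/
theorem abs_pathGreen_sub_torusGreen_le {x : ℝ} (hx : 0 < x) (s t : Fin n) :
    |pathGreen n x s t - cycleGreen n x (((s.val : ℕ) : ZMod n) - ((t.val : ℕ) : ZMod n))|
      ≤ Real.exp (-(latticeMass x * (n - ((max s.val t.val - min s.val t.val : ℕ) : ℝ))))
            / (Real.sinh (latticeMass x) * (1 - Real.exp (-(latticeMass x * n))))
        + (2 * Real.exp (-(latticeMass x * (((2 * n : ℕ) : ℝ) - ((max s.val t.val - min s.val t.val : ℕ) : ℝ))))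
            + Real.exp (-(latticeMass x * (s.val + t.val + 1))) + Real.exp (-(latticeMass x * (((2 * n : ℕ) : ℝ) - 1 - s.val - t.val))))
          / (2 * Real.sinh (latticeMass x) * (1 - Real.exp (-(latticeMass x * ((2 * n : ℕ) : ℝ))))) := by
  have hT := torusGreen_sub_line_bounds n hx s t
  have hB0 := pathGreen_sub_line_nonneg n hx s t
  have hB1 := pathGreen_sub_line_le n hx s t
  rw [abs_le]
  constructor <;> linarith [hT.1, hT.2]

end Twin

end Summit.QuantumFields.YangMills.BalabanUVNodes.N15KingModelRung.TorusSpectral
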